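import Summits.QuantumFields.BalabanUV.Beta.GAN24.ZeroModeSandwichSiteDep

/-!
# `BalabanUV.Beta.GAN24.FaceWeightedLinT2` — binder row G-an2-4 ∕ (CONV-C), W-slot (α-0), ROW (C) AT LEVELS `≥ 1`, the OWNER's two-index pair-form tower
# (`PairFormPeriodTower`, RULING R-gan24p1-g40-1), the TRANSPORT rows at EVERY face period — GENERIC ENGINE: **THE LINEAR SECOND-ORDER TRANSPORT
# `linT2 K N T` READ AGAINST BOUNDED COARSE WEIGHTS ON ITS FREE BOND AND ITS TWO LEGS, POINTWISE IN THE CELL BOND** (leaf-02 g15's `LinT2ZeroMode.zmode_one_linT2`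
# with SITE-DEPENDENT coarse-leg charges: the three weighted coarse sums need not be position-independent, so their values stay inside the fine sums)
# (road-P2 chair `b2b-balaban-gan24-p2`, gen 50; journal [GAN24P2-G50-INTENT2])

NOT IN PRINT; OUR BOOKKEEPING ([folklore] dominated Fubini BY NAME: leaf-02 g52's `ZeroModeSandwichSiteDep.nested_integrand_eq_dep` — leaf-02 g15's engine with
SITE-DEPENDENT coarse-leg charges (the majorant does not see the charges) — fed with the three scalar weights pushed onto the left leg, the free-bond column and the right leg;
0 `def`, 0 cited fact, 0 `def … : Prop`, 0 sorry).
HONEST FRAMING (cell contract, verbatim): «discharging `BetaPertH` makes Bałaban's UV stability UNCONDITIONAL — a real constructive-QFT result; it is NOT the continuum limit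
and NOT the Clay problem.»  HONEST DEPENDENCY (verbatim): «continuum YM on T⁴ ⇐ BetaPertH ∧ nine spine estimates (0/9 proved); BetaPertH ⇐ (D1) ∧ (D4) ∧ CAP+tail; G-an2-4
gates asym, D1 and NE2/3/4.»

WHY.  The OWNER's junction `PairFormPeriodTower.pairFormLS_tower₂` needs, at every period index `m ≥ 1`, the TRANSPORT row: the period-`P` four exit-face read of the linear part
`𝒜^E_j X = lin4 c G̃_j Lc X = −c·mmRead Lc (G̃_j ∘ vsym G̃_j Lc X ∘ G̃_j)` of road-P2's E-frame step (`T2RecOfUnitSplit`), i.e. the family `linT2 G̃_j Lc X` read against the face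
indicators `[y′_ν ≡ −1]`, `[x′_α ≡ −1]`, `[z′_β ≡ −1] (mod P)` on its free bond and its two (coarse) legs, the cell bond `y` running over `box P`.  Leaf-02 g15's
`zmode_one_linT2` is the UNWEIGHTED case (`P = 1`) where the three coarse-leg sums of `K` are position-independent scalars; with weights they are bounded FUNCTIONS of the fine
point (road-P2 g41's `ChargeTowerLegs.hasSum_row_coord_inl`: `−cH_j·𝟙[exit face of period Lc]·φ(block index)` — the DEEPER face), so the collapse keeps them inside.  This file is
the weighted reading, for ANY decaying `K`, ANY `LocStencil₂` table `T`, ANY bounded weights; the comb instance (`K = G̃_j`, face weights, the cell bond summed over `box P` by leaf-06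
g54's `JointPeriodicCellSwap.sum_box_tsum_swap`, the swapped bi-vertex by `KernelWardSwap.vertex2OfK_swap_eq_transpose`) is the sequel `GAN24/FaceReadTransportStep`.
WHAT (generic `d`, blocking `N ≥ 1`; `linT2` = `LinT2ZeroMode.linT2`, `integrand` = `ZeroModeSandwich.integrand`):
* **`weighted_linT2_apply_nested`** (the weighted summand as the eight inner nested sums of the weighted integrand), **`inner_weighted_linT2`** — for decaying `K`, a
  `LocStencil₂` table `T` (`δ > 0`), bounded weights `φ ψ₁ ψ₂` whose weighted coarse sums against `K`'s free-bond column ∕ left leg ∕ right leg have the `HasSum` values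
  `ch′ κ′ u′` ∕ `ca f x` ∕ `ck g z`:  `Σ'_{y′} Σ'_{x′} Σ'_{z′} φ y′·ψ₁ x′·ψ₂ z′·linT2 K N T μ y ν y′ x′ z′ (inl α)(inl β)
  = Σ_{g f κ κ′} Σ'_u colH K N μ y κ u · Σ'_{u′} Σ'_x Σ'_z T κ u κ′ u′ x z f g · (ca f x·(ch′ κ′ u′·ck g z))` — POINTWISE in the cell bond `(μ, y)`, no covariance needed.
Asserts NO value and NO shape of Bałaban's tables; discharges NOTHING of (C)_{≥1} ∕ `hstep` ∕ `hSrc` ∕ `hSrcX`; NEVER «G-an2-4 closed» as (CONV-C); NOT D1, NOT `BetaPertH`,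
NOT continuum, NOT Clay.  2026-08-24; no existing file touched.
-/

noncomputable section

open Finset
open scoped BigOperators
open Literature.MathematicalPhysics.QuantumFieldTheory
open Literature.MathematicalPhysics.QuantumFieldTheory.Balaban1983to89
open Literature.MathematicalPhysics.QuantumFieldTheory.Balaban1983to89.Beta
open B12Sec2to5 (l1)
open ExpKernelCalculus (MKer Decays comp)
open OneStepResolventKernel (Fib wsum)
open OneStepKernelFamily (colH abs_colH_le vertexOfK)
open BalabanCompositeJets (LocStencil₂)
open SecondOrderResponse (vertex2OfK)
open BalabanStepJetsSucc (mmRead mmRead_inl_inl)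
open AffineAveraging (box toSite)
open Summit.QuantumFields.BalabanUV.Beta.GAN24.BiStencilZeroMode (Tab)
open Summit.QuantumFields.BalabanUV.Beta.GAN24.ZeroModeSandwich (integrand)
open Summit.QuantumFields.BalabanUV.Beta.GAN24.ZeroModeSandwichSiteDep (nested_integrand_eq_dep)
open Summit.QuantumFields.BalabanUV.Beta.GAN24.LinT2ZeroMode (linT2 abs_le_of_locStencil₂)

namespace Summit.QuantumFields.BalabanUV.Beta.GAN24.FaceWeightedLinT2

/-! ## The linear second-order transport against bounded weights on the free bond and the two legs, pointwise in the cell bond -/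

section Weighted

variable {d N : ℕ} [NeZero N]

omit [NeZero N] in
/-- [folklore] **THE WEIGHTED SUMMAND AS EIGHT NESTED SUMS OF THE WEIGHTED SANDWICH INTEGRAND** (leaf-02 g15's unfolding of `linT2`, at a general cell bond `(μ, y)`, with the
three scalar weights pushed onto the left leg, the free-bond column and the right leg). -/
theorem weighted_linT2_apply_nested (K : MKer (d + 1) (Fib d)) (T : Tab d) (φ ψ₁ ψ₂ : (Fin (d + 1) → ℤ) → ℝ)
    (μ : Fin (d + 1)) (y : Fin (d + 1) → ℤ) (ν : Fin (d + 1)) (y' x' z' : Fin (d + 1) → ℤ) (α β : Fin (d + 1)) :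
    φ y' * ψ₁ x' * ψ₂ z' * linT2 K N T μ y ν y' x' z' (Sum.inl α) (Sum.inl β)
      = ∑' z, ∑ g, ∑' x, ∑ f, ∑ κ, ∑' u, ∑ κ', ∑' u',
          integrand (fun f x' x => ψ₁ x' * K ((N : ℤ) • x') x (Sum.inr α) f) (fun κ u => colH K N μ y κ u)
            (fun κ' y' u' => φ y' * colH K N ν y' κ' u') (fun f g κ κ' u u' x z => T κ u κ' u' x z f g)
            (fun g z z' => ψ₂ z' * K z ((N : ℤ) • z') g (Sum.inr β)) y' x' z' z g x f κ u κ' u' := by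
  simp only [linT2, mmRead_inl_inl, comp, vertex2OfK, vertexOfK, wsum, integrand]
  rw [← tsum_mul_left]
  refine tsum_congr fun z => ?_
  rw [Finset.mul_sum]
  refine Finset.sum_congr rfl fun g _ => ?_
  rw [← tsum_mul_right, ← tsum_mul_left]
  refine tsum_congr fun x => ?_
  rw [Finset.sum_mul, Finset.mul_sum]
  refine Finset.sum_congr rfl fun f _ => ?_
  rw [Finset.mul_sum, Finset.sum_mul, Finset.mul_sum]
  refine Finset.sum_congr rfl fun κ _ => ?_
  rw [← tsum_mul_left, ← tsum_mul_right, ← tsum_mul_left]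
  refine tsum_congr fun u => ?_
  rw [Finset.mul_sum, Finset.mul_sum, Finset.sum_mul, Finset.mul_sum]
  refine Finset.sum_congr rfl fun κ' _ => ?_
  rw [← tsum_mul_left, ← tsum_mul_left, ← tsum_mul_right, ← tsum_mul_left]
  refine tsum_congr fun u' => ?_
  ring

/-- NOT IN PRINT; OUR BOOKKEEPING.  **THE LINEAR SECOND-ORDER TRANSPORT AGAINST BOUNDED WEIGHTS, POINTWISE IN THE CELL BOND.**  Let `K` decay (`m > 0`), `T` be a `LocStencil₂`
family (`δ > 0`), `φ ψ₁ ψ₂` bounded weights on the free bond `y′` and the two coarse legs `x′`, `z′`, and let the WEIGHTED coarse sums have the (site-dependent) values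
`Σ'_{x′} ψ₁ x′·K (N•x′) x (inr α) f = ca f x`, `Σ'_{y′} φ y′·colH K N ν y′ κ′ u′ = ch′ κ′ u′`, `Σ'_{z′} ψ₂ z′·K z (N•z′) g (inr β) = ck g z`.  Then for every cell bond `(μ, y)`:
`Σ'_{y′} Σ'_{x′} Σ'_{z′} φ y′·ψ₁ x′·ψ₂ z′·linT2 K N T μ y ν y′ x′ z′ (inl α)(inl β) = Σ_{g f κ κ′} Σ'_u colH K N μ y κ u · Σ'_{u′} Σ'_x Σ'_z T κ u κ′ u′ x z f g·(ca f x·(ch′ κ′ u′·ck g z))`. -/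
theorem inner_weighted_linT2 {K : MKer (d + 1) (Fib d)} {C m : ℝ} (hK : Decays K C m) (hm : 0 < m)
    {T : Tab d} {CT δ : ℝ} (hT : LocStencil₂ T CT δ) (hδ : 0 < δ)
    {φ ψ₁ ψ₂ : (Fin (d + 1) → ℤ) → ℝ} {Bφ B₁ B₂ : ℝ} (hφ : ∀ y', |φ y'| ≤ Bφ) (hψ₁ : ∀ x', |ψ₁ x'| ≤ B₁) (hψ₂ : ∀ z', |ψ₂ z'| ≤ B₂)
    (μ : Fin (d + 1)) (y : Fin (d + 1) → ℤ) (ν α β : Fin (d + 1))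
    {ca : Fib d → (Fin (d + 1) → ℤ) → ℝ} {ch' : Fin (d + 1) → (Fin (d + 1) → ℤ) → ℝ} {ck : Fib d → (Fin (d + 1) → ℤ) → ℝ}
    (has : ∀ f x, HasSum (fun x' : Fin (d + 1) → ℤ => ψ₁ x' * K ((N : ℤ) • x') x (Sum.inr α) f) (ca f x))
    (hhs : ∀ κ' u', HasSum (fun y' : Fin (d + 1) → ℤ => φ y' * colH K N ν y' κ' u') (ch' κ' u'))
    (hks : ∀ g z, HasSum (fun z' : Fin (d + 1) → ℤ => ψ₂ z' * K z ((N : ℤ) • z') g (Sum.inr β)) (ck g z)) :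
    (∑' y', ∑' x', ∑' z', φ y' * ψ₁ x' * ψ₂ z' * linT2 K N T μ y ν y' x' z' (Sum.inl α) (Sum.inl β))
      = ∑ g : Fib d, ∑ f : Fib d, ∑ κ : Fin (d + 1), ∑ κ' : Fin (d + 1),
          ∑' u, colH K N μ y κ u * ∑' u', ∑' x, ∑' z, T κ u κ' u' x z f g * (ca f x * (ch' κ' u' * ck g z)) := by
  have hC : 0 ≤ C := hK.nonneg (Sum.inl 0)
  have bnd : ∀ (w : (Fin (d + 1) → ℤ) → ℝ) (B : ℝ) (_ : ∀ s, |w s| ≤ B) (s : Fin (d + 1) → ℤ) (v e : ℝ) (_ : |v| ≤ C * e) (_ : 0 ≤ e),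
      |w s * v| ≤ B * C * e := by
    intro w B hw s v e hv he
    rw [abs_mul, mul_assoc]
    exact mul_le_mul (hw s) hv (abs_nonneg _) ((abs_nonneg _).trans (hw s))
  simp_rw [weighted_linT2_apply_nested]
  rw [nested_integrand_eq_dep (N := N) (u₀ := (N : ℤ) • y) hm hδ
    (fun f x' x => bnd ψ₁ B₁ hψ₁ x' _ _ (hK _ _ _ _) (Real.exp_pos _).le)
    (fun κ u => abs_colH_le hK μ y κ u)
    (fun κ' y' u' => bnd φ Bφ hφ y' _ _ (abs_colH_le hK ν y' κ' u') (Real.exp_pos _).le)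
    (fun f g κ κ' u u' x z => abs_le_of_locStencil₂ hT κ u κ' u' x z f g)
    (fun g z z' => bnd ψ₂ B₂ hψ₂ z' _ _ (hK _ _ _ _) (Real.exp_pos _).le)
    has hhs hks]
  refine Finset.sum_congr rfl fun g _ => Finset.sum_congr rfl fun f _ => Finset.sum_congr rfl fun κ _ =>
    Finset.sum_congr rfl fun κ' _ => ?_
  refine tsum_congr fun u => ?_
  simp_rw [mul_assoc, tsum_mul_left]

end Weighted

end Summit.QuantumFields.BalabanUV.Beta.GAN24.FaceWeightedLinT2

end
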